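import Literature.MathematicalPhysics.QuantumLattice.QuantumSpinChessboardEstimate
import HarnessLib

/-!
# The chessboard estimate for the Heisenberg antiferromagnet in its physical frame: Néel-staggered
# universal observables (Fröhlich–Lieb 1978, §I.A model (3), eq. (1.4a); Thm. 2.2)

Topic `MathematicalPhysics/QuantumLattice`; companion of `QuantumSpinChessboardEstimate.lean`. That
file proves the chessboard estimate for exponents of the Fröhlich–Lieb form (2.5) and instantiates
it for the tree's ROTATED antiferromagnets (`heisWeightedRealFieldHamiltonian L n w 0`: all bond
terms "(real matrix at `i`) ⊗ (real matrix at `j`)", FL (1.4a)). Fröhlich–Lieb, §I.A (3): "This is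
obtained by making a rotation of `π` about the y-axis for the spins on one of the two sublattices;
for such spin operators `S^z → -S^z`, `S^x → -S^x`, `S^y → +S^y`. In this representation all the
terms in (1.3) are then of the form—(real matrix at i) (real matrix at j). Then reflection
positivity … holds." This file carries the estimate back to the PHYSICAL antiferromagnet
`H_w = Σ_{⟨xy⟩} w_{xy} 𝐒_x·𝐒_y` (tree `heisWeightedHamiltonian`; in particular the model with
direction-dependent couplings `heisAnisoTorus L n K` of Kennedy–Lieb–Shastry eq. (5)):

* `exists_productOp_conj_heisWeightedFieldHamiltonian` — the odd-sublattice rotation as an explicit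
  PRODUCT unitary `⨂_z u_z`, `u_z = 1` on the even and `u_z = R` on the odd sublattice, with
  `R S³ Rᴴ = -S³` (the tree's `exists_unitary_conj_heisWeightedFieldHamiltonian` hides the product
  structure behind `∃ W`; the proof is the same);
* `conj_diagonal_of_conj_spinZ_eq_neg` — a unitary `R` with `R S³ Rᴴ = -S³` maps every function of
  `S³`, `diag(d₀, …, d_n)`, to `diag(d_n, …, d₀)` (it is supported on the anti-diagonal, `S³`
  having the simple spectrum `n/2, n/2 - 1, …, -n/2`), i.e. `P^{+δ} ↔ P^{-δ}` (FL §I.B);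
* **`heisWeighted_chessboard_estimate_neel`** — for the Gibbs state of the physical antiferromagnet
  with reflection-invariant couplings `w ≥ 0` on the even torus (`d ≥ 1`, even side `L ≥ 3`),
  every spin, every `β ≥ 0`, every family `d_b` of REAL diagonal single-site observables
  (functions of `S³_x`, e.g. the spectral projections `P^{±δ}` of FL §I.B) and every assignment
  `σ`: `|Re⟨⨂_x N_x(d_{σ_x})⟩|^{L^d} ≤ ∏_x Re⟨⨂_y N_y(d_{σ_x})⟩`, where `N_y(d) = diag(d)` on the
  even sublattice and `diag(d reversed)` (`m ↦ -m`) on the odd one (`neelDiagonal`): in the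
  physical frame the universal observable of a label is its NÉEL-STAGGERED pattern (FL §I.B (3):
  the order parameter of model (3) is the staggered magnetisation `(-1)^{i₁+i₂} Sᶻ_i`);
  `heisAniso_chessboard_estimate_neel` — the same for `heisAnisoTorus L n K`, `K ≥ 0`.

No named facts; no sorries.

## References

* J. Fröhlich, E. H. Lieb, *Phase transitions in anisotropic lattice spin systems*, Comm. Math.
  Phys. **60** (1978) 233–267, §I.A model (3) and eq. (1.4a), §I.B, Thm. 2.2 (Selecta pp. 236–238,
  250–253). [FrohlichLieb1978]
* F. J. Dyson, E. H. Lieb, B. Simon, J. Stat. Phys. **18** (1978) 335–383, §2 (the sublattice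
  rotation). [DLS1978]
* T. Kennedy, E. H. Lieb, B. S. Shastry, J. Stat. Phys. **53** (1988) 1019–1030, eqs. (5),
  (15)–(17). [KLS1988JSP]
-/

noncomputable section

open Matrix Finset NormedSpace
open scoped Kronecker ComplexOrder BigOperators
open Literature.MathematicalPhysics.QuantumLattice Literature.Probability.LatticeModels
  Literature.MathematicalPhysics.QuantumLattice.SpinOperators

namespace Literature.MathematicalPhysics.QuantumLattice

variable {d : ℕ}

/-! ### The odd-sublattice rotation as a product unitary -/

section Rotation

variable (L : ℕ) [NeZero L]

/-- **The sublattice rotation as a product unitary** (DLS 1978 §2; KLS eqs. (15)–(17); FL §I.A (3)):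
on the even torus of side `L ≥ 3` and for every spin `n/2` there is a single-site unitary `R`
with `R S³ Rᴴ = -S³` (the rotation by `π` about the `2`-axis) such that the product unitary
`U = ⨂_z u_z`, `u_z = 1` on the even sublattice and `u_z = R` on the odd one, conjugates every
weighted field Hamiltonian into its real form: `U H_w(h) Uᴴ = H♭_w(h)` (bond by bond). This is the
tree's `exists_unitary_conj_heisWeightedFieldHamiltonian` with the product structure of the unitary
made explicit (same proof). [cite: KLS1988JSP, eqs. (15)–(17)] [cite: DLS1978, §2] -/
theorem exists_productOp_conj_heisWeightedFieldHamiltonian (hL : Even L) (hL3 : 3 ≤ L) (n : ℕ) :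
    ∃ R : Matrix (Fin (n + 1)) (Fin (n + 1)) ℂ, R * Rᴴ = 1 ∧ Rᴴ * R = 1 ∧
      R * SpinOperators.spinZ n * Rᴴ = -SpinOperators.spinZ n ∧
      ∀ (w : Sym2 (TorusSite d L) → ℝ) (h : TorusSite d L → ℝ),
        productOp (fun z => if torusSiteParity L hL z = 0 then 1 else R) *
            heisWeightedFieldHamiltonian L n w h *
            (productOp (fun z => if torusSiteParity L hL z = 0 then 1 else R))ᴴ =
          heisWeightedRealFieldHamiltonian L n w h := by
  obtain ⟨k, rfl⟩ : ∃ k, L = 2 * k := ⟨L / 2, by obtain ⟨k, hk⟩ := hL; omega⟩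
  set E := (torusGraph d (2 * k)).edgeFinset with hE
  -- the single-site rotation `R = V²` (`π` about the `2`-axis): `Sˣ ↦ -Sˣ`, `Sʸ ↦ Sʸ`, `Sᶻ ↦ -Sᶻ`
  obtain ⟨V, hV, hV', hVz, hVx, hVy⟩ := exists_unitary_conj_spinZ_eq_spinX n
  set R := V * V with hR
  have hRR : R * Rᴴ = 1 := by
    rw [hR, conjTranspose_mul, Matrix.mul_assoc, ← Matrix.mul_assoc V Vᴴ, hV, Matrix.one_mul, hV]
  have hRR' : Rᴴ * R = 1 := by
    rw [hR, conjTranspose_mul, Matrix.mul_assoc, ← Matrix.mul_assoc Vᴴ V, hV', Matrix.one_mul, hV']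
  have hRz : R * SpinOperators.spinZ n * Rᴴ = -SpinOperators.spinZ n := by
    rw [hR, conjTranspose_mul, show V * V * SpinOperators.spinZ n * (Vᴴ * Vᴴ) =
      V * (V * SpinOperators.spinZ n * Vᴴ) * Vᴴ by simp only [Matrix.mul_assoc], hVz, hVx]
  have hRy : R * spinY n * Rᴴ = spinY n := by
    rw [hR, conjTranspose_mul, show V * V * spinY n * (Vᴴ * Vᴴ) =
      V * (V * spinY n * Vᴴ) * Vᴴ by simp only [Matrix.mul_assoc], hVy, hVy]
  have hRx : R * spinX n * Rᴴ = -spinX n := by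
    rw [hR, conjTranspose_mul, show V * V * spinX n * (Vᴴ * Vᴴ) =
      V * (V * spinX n * Vᴴ) * Vᴴ by simp only [Matrix.mul_assoc], hVx, Matrix.mul_neg,
      Matrix.neg_mul, hVz]
  refine ⟨R, hRR, hRR', hRz, fun w h => ?_⟩
  -- the product unitary on the odd sublattice
  set ε : TorusSite d (2 * k) → ZMod 2 := torusSiteParity (2 * k) hL with hε
  set u : TorusSite d (2 * k) → Matrix (Fin (n + 1)) (Fin (n + 1)) ℂ :=
    fun z => if ε z = 0 then 1 else R with hu
  have hua : ∀ z, u z * (u z)ᴴ = 1 := by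
    intro z; simp only [hu]; split_ifs
    · rw [conjTranspose_one, Matrix.mul_one]
    · exact hRR
  have hub : ∀ z, (u z)ᴴ * u z = 1 := by
    intro z; simp only [hu]; split_ifs
    · rw [conjTranspose_one, Matrix.mul_one]
    · exact hRR'
  set sgn : TorusSite d (2 * k) → ℂ := fun z => if ε z = 0 then 1 else -1 with hsgn
  have hsgnN : ∀ z, (neelSign z : ℂ) = sgn z := fun z => neelSign_eq_ite k z
  have hsgn2 : ∀ z, sgn z * sgn z = 1 := by
    intro z; simp only [hsgn]; split_ifs <;> norm_num
  have hux : ∀ z, u z * spinX n * (u z)ᴴ = sgn z • spinX n := by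
    intro z; simp only [hu, hsgn]; split_ifs
    · rw [conjTranspose_one, Matrix.mul_one, Matrix.one_mul, one_smul]
    · rw [hRx, neg_one_smul]
  have huy : ∀ z, u z * spinY n * (u z)ᴴ = spinY n := by
    intro z; simp only [hu]; split_ifs
    · rw [conjTranspose_one, Matrix.mul_one, Matrix.one_mul]
    · exact hRy
  have huz : ∀ z, u z * SpinOperators.spinZ n * (u z)ᴴ = sgn z • SpinOperators.spinZ n := by
    intro z; simp only [hu, hsgn]; split_ifs
    · rw [conjTranspose_one, Matrix.mul_one, Matrix.one_mul, one_smul]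
    · rw [hRz, neg_one_smul]
  have hedge : ∀ e ∈ E, ∀ x y, e = s(x, y) → sgn x * sgn y = -1 := by
    intro e he x y hexy
    subst hexy
    rw [hE, SimpleGraph.mem_edgeFinset, SimpleGraph.mem_edgeSet, torusGraph_adj_iff] at he
    have h01 : ∀ t : ZMod 2, t = 0 ∨ t = 1 := by decide
    have key : ∀ x' : TorusSite d (2 * k), ∀ i, sgn x' * sgn (x' + Pi.single i 1) = -1 := by
      intro x' i
      have hpar : ε (x' + Pi.single i 1) = ε x' + 1 := torusSiteParity_add_single (2 * k) hL x' i
      simp only [hsgn, hpar]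
      rcases h01 (ε x') with h0 | h1
      · rw [if_pos h0, if_neg (by rw [h0]; decide), one_mul]
      · rw [if_neg (by rw [h1]; decide), if_pos (by rw [h1]; decide), mul_one]
    obtain ⟨-, ⟨i, rfl⟩ | ⟨i, rfl⟩⟩ := he
    · exact key x i
    · rw [mul_comm]; exact key y i
  set W := productOp u with hW
  -- conjugation of the atoms
  have hWs : ∀ x : TorusSite d (2 * k), W * stagSiteSpinX (2 * k) n x * Wᴴ = siteSpin n x 0 := by
    intro x
    rw [stagSiteSpinX, Matrix.mul_smul, Matrix.smul_mul, hW, productOp_conj_siteSpin hua,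
      spinVec_zero, hux, onSite_smul', smul_smul, hsgnN, hsgn2, one_smul]
    rfl
  have hb0 : ∀ x y : TorusSite d (2 * k), sgn x * sgn y = -1 →
      W * spinBond n 0 x y * Wᴴ = -spinBond n 0 x y := by
    intro x y hxy
    rw [hW, productOp_conj_spinBond hua hub, spinVec_zero, hux, hux, onSite_smul', onSite_smul',
      smul_mul_smul_comm, smul_mul_smul_comm, mul_comm (sgn y) (sgn x), hxy, spinBond]
    simp only [neg_smul, one_smul]
    rw [← neg_add, smul_neg]
    rfl
  have hb1 : ∀ x y : TorusSite d (2 * k), W * spinBond n 1 x y * Wᴴ = spinBond n 1 x y := by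
    intro x y
    rw [hW, productOp_conj_spinBond hua hub, spinVec_one, huy, huy, spinBond]
    rfl
  have hb2 : ∀ x y : TorusSite d (2 * k), sgn x * sgn y = -1 →
      W * spinBond n 2 x y * Wᴴ = -spinBond n 2 x y := by
    intro x y hxy
    rw [hW, productOp_conj_spinBond hua hub, spinVec_two, huz, huz, onSite_smul', onSite_smul',
      smul_mul_smul_comm, smul_mul_smul_comm, mul_comm (sgn y) (sgn x), hxy, spinBond]
    simp only [neg_smul, one_smul]
    rw [← neg_add, smul_neg]
    rfl
  have hW1 : W * (1 : Op (TorusSite d (2 * k)) (n + 1)) * Wᴴ = 1 := by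
    rw [Matrix.mul_one, hW, productOp_mul_conjTranspose hua]
  -- bond by bond
  have hbond : ∀ e ∈ E,
      W * Sym2.lift ⟨fun x y => heisFieldBond (2 * k) n h x y,
          fun x y => heisFieldBond_comm (2 * k) n h x y⟩ e * Wᴴ =
        Sym2.lift ⟨fun x y => heisRealBond n h x y, fun x y => heisRealBond_comm n h x y⟩ e := by
    intro e he
    induction e using Sym2.ind with
    | h x y =>
      have hs := hedge _ he x y rfl
      simp only [Sym2.lift_mk, heisRealBond, xyRealBond, heisFieldBond, Matrix.mul_add,
        Matrix.add_mul, Matrix.mul_sub, Matrix.sub_mul, Matrix.mul_smul, Matrix.smul_mul,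
        hb0 x y hs, hb1, hb2 x y hs, hW1, hWs]
      abel
  rw [heisWeightedFieldHamiltonian, heisWeightedRealFieldHamiltonian, Finset.mul_sum,
    Finset.sum_mul]
  refine sum_congr rfl fun e he => ?_
  rw [Matrix.mul_smul, Matrix.smul_mul, hbond e he]

end Rotation

/-! ### Unitaries anticommuting with `S³` reverse the diagonal -/

section Antidiagonal

variable {n : ℕ}

/-- A matrix `R` with `Rᴴ R = 1` and `R S³ Rᴴ = -S³` is supported on the anti-diagonal:
`R_{kl} = 0` unless `l = n - k` (`S³ = diag(n/2 - k)` has simple spectrum and `R` maps the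
`m`-eigenvector to the `-m`-eigenvector) — the sublattice rotation of FL §I.A (3) exchanges
`S³ = m` with `S³ = -m`. [cite: FrohlichLieb1978, §I.A (3)] -/
theorem apply_eq_zero_of_conj_spinZ_eq_neg {R : Matrix (Fin (n + 1)) (Fin (n + 1)) ℂ}
    (hRR' : Rᴴ * R = 1) (hRz : R * SpinOperators.spinZ n * Rᴴ = -SpinOperators.spinZ n)
    {k l : Fin (n + 1)} (hkl : l ≠ Fin.rev k) : R k l = 0 := by
  -- `R S³ = -S³ R`
  have hanti : R * SpinOperators.spinZ n = -(SpinOperators.spinZ n * R) := by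
    have h := congrArg (· * R) hRz
    simpa only [Matrix.mul_assoc, hRR', Matrix.mul_one, Matrix.neg_mul] using h
  have hentry := congrFun (congrFun hanti k) l
  rw [Matrix.neg_apply, Matrix.mul_apply, Matrix.mul_apply,
    Finset.sum_eq_single l (fun j _ hj => by rw [spinZ_apply, if_neg hj, mul_zero])
      (fun h => absurd (mem_univ l) h),
    Finset.sum_eq_single k (fun j _ hj => by rw [spinZ_apply, if_neg (Ne.symm hj), zero_mul])
      (fun h => absurd (mem_univ k) h),
    spinZ_apply, if_pos rfl, spinZ_apply, if_pos rfl] at hentry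
  -- `R_{kl} (n/2 - l) = -(n/2 - k) R_{kl}`, i.e. `R_{kl} (n - k - l) = 0`
  have hsum : R k l * ((n : ℂ) - (k : ℂ) - (l : ℂ)) = 0 := by
    have h1 : R k l * ((n : ℂ) / 2 - (l : ℂ)) + ((n : ℂ) / 2 - (k : ℂ)) * R k l = 0 := by
      rw [hentry]; ring
    have h2 : R k l * ((n : ℂ) - (k : ℂ) - (l : ℂ)) =
        R k l * ((n : ℂ) / 2 - (l : ℂ)) + ((n : ℂ) / 2 - (k : ℂ)) * R k l := by ring
    rw [h2, h1]
  rcases mul_eq_zero.1 hsum with h | h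
  · exact h
  · exfalso
    apply hkl
    have hkl' : (k : ℕ) + (l : ℕ) = n := by
      have h' : (((k : ℕ) + (l : ℕ) : ℕ) : ℂ) = (n : ℂ) := by
        push_cast
        linear_combination -h
      exact_mod_cast h'
    ext
    rw [Fin.val_rev]
    omega

/-- **`R diag(d) Rᴴ = diag(d reversed)`** for a unitary `R` with `R S³ Rᴴ = -S³`: the sublattice
rotation maps every function of `S³` to the same function of `-S³` (`P^{+δ} ↔ P^{-δ}`, FL §I.B).
[cite: FrohlichLieb1978, §I.A (3), §I.B] -/
theorem conj_diagonal_of_conj_spinZ_eq_neg {R : Matrix (Fin (n + 1)) (Fin (n + 1)) ℂ}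
    (hRR : R * Rᴴ = 1) (hRR' : Rᴴ * R = 1)
    (hRz : R * SpinOperators.spinZ n * Rᴴ = -SpinOperators.spinZ n) (dd : Fin (n + 1) → ℂ) :
    R * diagonal dd * Rᴴ = diagonal (fun k => dd (Fin.rev k)) := by
  have hzero : ∀ k l, l ≠ Fin.rev k → R k l = 0 := fun k l hkl =>
    apply_eq_zero_of_conj_spinZ_eq_neg hRR' hRz hkl
  ext i j
  rw [Matrix.mul_apply, diagonal_apply,
    Finset.sum_eq_single (Fin.rev i) (fun l _ hl => by
      rw [Matrix.mul_apply, Finset.sum_eq_single l (fun m _ hm => by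
        rw [diagonal_apply_ne _ hm, mul_zero]) (fun h => absurd (mem_univ l) h),
        diagonal_apply_eq, hzero i l hl, zero_mul, zero_mul])
    (fun h => absurd (mem_univ _) h),
    Matrix.mul_apply, Finset.sum_eq_single (Fin.rev i) (fun m _ hm => by
      rw [diagonal_apply_ne _ hm, mul_zero]) (fun h => absurd (mem_univ _) h),
    diagonal_apply_eq, conjTranspose_apply]
  rcases eq_or_ne i j with rfl | hij
  · rw [if_pos rfl]
    -- `|R_{i, rev i}|² = 1` from `R Rᴴ = 1`
    have hone := congrFun (congrFun hRR i) i
    rw [Matrix.mul_apply, Matrix.one_apply_eq,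
      Finset.sum_eq_single (Fin.rev i) (fun l _ hl => by
        rw [hzero i l hl, zero_mul]) (fun h => absurd (mem_univ _) h), conjTranspose_apply] at hone
    rw [mul_comm (R i (Fin.rev i)) (dd _), mul_assoc, hone, mul_one]
  · rw [if_neg hij]
    have hj : Fin.rev i ≠ Fin.rev j := fun h => hij (Fin.rev_injective h)
    rw [hzero j (Fin.rev i) hj, star_zero, mul_zero]

/-- `Rᴴ diag(d) R = diag(d reversed)` as well (apply the previous lemma to `Rᴴ`, which also
anticommutes with `S³`). [cite: FrohlichLieb1978, §I.A (3), §I.B] -/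
theorem conjTranspose_conj_diagonal_of_conj_spinZ_eq_neg {R : Matrix (Fin (n + 1)) (Fin (n + 1)) ℂ}
    (hRR : R * Rᴴ = 1) (hRR' : Rᴴ * R = 1)
    (hRz : R * SpinOperators.spinZ n * Rᴴ = -SpinOperators.spinZ n) (dd : Fin (n + 1) → ℂ) :
    Rᴴ * diagonal dd * R = diagonal (fun k => dd (Fin.rev k)) := by
  have hRz' : Rᴴ * SpinOperators.spinZ n * Rᴴᴴ = -SpinOperators.spinZ n := by
    rw [conjTranspose_conjTranspose]
    have h := congrArg (fun X => Rᴴ * X * R) hRz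
    simp only [Matrix.mul_neg, Matrix.neg_mul] at h
    simp only [← Matrix.mul_assoc, hRR', Matrix.one_mul] at h
    rw [Matrix.mul_assoc (SpinOperators.spinZ n), hRR', Matrix.mul_one] at h
    exact neg_eq_iff_eq_neg.mp h.symm
  have h := conj_diagonal_of_conj_spinZ_eq_neg
    (by rw [conjTranspose_conjTranspose]; exact hRR')
    (by rw [conjTranspose_conjTranspose]; exact hRR) hRz' dd
  rwa [conjTranspose_conjTranspose] at h

end Antidiagonal

/-! ### The chessboard estimate in the physical frame -/

section Physical

variable (L : ℕ) [NeZero L]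

/-- Unitary covariance of Gibbs states: `⟨Wᴴ B W⟩_{β, Wᴴ X W} = ⟨B⟩_{β,X}` for unitary `W`
(`e^{Wᴴ X W} = Wᴴ e^X W`, cyclicity of the trace; the tree's `Matrix.gibbsState_unitary_conj`,
reproved here to keep the imports light). [cite: BratteliRobinsonII1997, §5.3.1] -/
private theorem neelAux_gibbsState_unitary_conj {m : Type*} [Fintype m] [DecidableEq m] (β : ℝ)
    {W : Matrix m m ℂ} (hWW : Wᴴ * W = 1) (hWW' : W * Wᴴ = 1) (X B : Matrix m m ℂ) :
    Matrix.gibbsState β (Wᴴ * X * W) (Wᴴ * B * W) = Matrix.gibbsState β X B := by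
  have hU : IsUnit Wᴴ := ⟨⟨Wᴴ, W, hWW, hWW'⟩, rfl⟩
  have hinv : Wᴴ⁻¹ = W := Matrix.inv_eq_right_inv hWW
  have hexp : gibbsWeight β (Wᴴ * X * W) = Wᴴ * gibbsWeight β X * W := by
    unfold gibbsWeight
    rw [show -(β : ℂ) • (Wᴴ * X * W) = Wᴴ * (-(β : ℂ) • X) * Wᴴ⁻¹ by
      rw [hinv, Matrix.mul_smul, Matrix.smul_mul], Matrix.exp_conj _ _ hU, hinv]
  have h1 : (Wᴴ * gibbsWeight β X * W).trace = (gibbsWeight β X).trace := by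
    rw [Matrix.trace_mul_cycle, hWW', Matrix.one_mul]
  have h2 : (Wᴴ * gibbsWeight β X * W * (Wᴴ * B * W)).trace = (gibbsWeight β X * B).trace := by
    have e : Wᴴ * gibbsWeight β X * W * (Wᴴ * B * W) = Wᴴ * (gibbsWeight β X * B) * W := by
      calc Wᴴ * gibbsWeight β X * W * (Wᴴ * B * W)
          = Wᴴ * gibbsWeight β X * (W * Wᴴ) * B * W := by simp only [Matrix.mul_assoc]
        _ = Wᴴ * (gibbsWeight β X * B) * W := by rw [hWW', Matrix.mul_one, Matrix.mul_assoc Wᴴ]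
    rw [e, Matrix.trace_mul_cycle, hWW', Matrix.one_mul]
  rw [Matrix.gibbsState_apply, Matrix.gibbsState_apply, partitionFn, partitionFn, hexp, h1, h2]

/-- **The Néel placement of a diagonal single-site observable** on the even torus: `diag(d)` on
the even sublattice, `diag(d reversed)` (`S³ = m ↦ -m`) on the odd sublattice — the image of the
constant observable `diag(d)` under the sublattice rotation of FL §I.A (3).
[cite: FrohlichLieb1978, §I.A (3), §I.B] -/
def neelDiagonal (hL : Even L) {n : ℕ} (dd : Fin (n + 1) → ℂ) (y : TorusSite d L) :
    Matrix (Fin (n + 1)) (Fin (n + 1)) ℂ :=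
  if torusSiteParity L hL y = 0 then diagonal dd else diagonal fun k => dd (Fin.rev k)

omit [NeZero L] in
/-- On the even sublattice the Néel placement is `diag(d)`. [cite: FrohlichLieb1978, §I.B] -/
theorem neelDiagonal_of_even (hL : Even L) {n : ℕ} (dd : Fin (n + 1) → ℂ) {y : TorusSite d L}
    (hy : torusSiteParity L hL y = 0) : neelDiagonal L hL dd y = diagonal dd := by
  rw [neelDiagonal, if_pos hy]

omit [NeZero L] in
/-- On the odd sublattice the Néel placement is `diag(d reversed)`.
[cite: FrohlichLieb1978, §I.B] -/
theorem neelDiagonal_of_odd (hL : Even L) {n : ℕ} (dd : Fin (n + 1) → ℂ) {y : TorusSite d L}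
    (hy : torusSiteParity L hL y ≠ 0) :
    neelDiagonal L hL dd y = diagonal fun k => dd (Fin.rev k) := by
  rw [neelDiagonal, if_neg hy]

/-- **The chessboard estimate for the physical Heisenberg antiferromagnet with reflection-invariant
couplings, diagonal observables** (Fröhlich–Lieb Thm. 2.2 for their model (3), stated in the
original frame): on the even torus of dimension `d ≥ 1` and even side `L ≥ 3`, for nonnegative
bond weights `w` invariant under all reflections between sites, every spin `n/2`, every `β ≥ 0`,
every family of REAL diagonal single-site observables `d_b` (functions of `S³`) and every
assignment `σ`, the Gibbs state of `H_w = Σ w_{xy} 𝐒_x·𝐒_y` obeys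
`|Re⟨⨂_x N_x(d_{σ_x})⟩|^{L^d} ≤ ∏_x Re⟨⨂_y N_y(d_{σ_x})⟩`,
`N_y(d)` the Néel placement (`diag d` on the even, `diag(d reversed)` on the odd sublattice): the
universal observable of a label is its Néel-staggered pattern. Proof: the rotated-frame estimate
`chessboard_estimate_gibbs_real` for `H♭_w = U H_w Uᴴ`, `U` the product unitary of
`exists_productOp_conj_heisWeightedFieldHamiltonian`, unitary covariance of the Gibbs state, and
`Uᴴ (⨂ diag d_{σ_x}) U = ⨂_x N_x(d_{σ_x})` (`conj_diagonal_of_conj_spinZ_eq_neg`).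
[cite: FrohlichLieb1978, Thm. 2.2, §I.A (3)] -/
theorem heisWeighted_chessboard_estimate_neel (hd : 0 < d) (hL : Even L) (hL3 : 3 ≤ L) (n : ℕ)
    {w : Sym2 (TorusSite d L) → ℝ} (hw0 : ∀ e, 0 ≤ w e)
    (hwθ : ∀ (j : Fin d) (a : ZMod L) (e : Sym2 (TorusSite d L)),
      w (e.map (Torus.reflectBetweenSites j a)) = w e)
    {β : ℝ} (hβ : 0 ≤ β) {ι : Type*} (dd : ι → Fin (n + 1) → ℝ) (σ : TorusSite d L → ι) :
    |(Matrix.gibbsState β (heisWeightedHamiltonian L n w)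
        (productOp fun x => neelDiagonal L hL (fun k => (dd (σ x) k : ℂ)) x)).re| ^ (L ^ d) ≤
      ∏ x, (Matrix.gibbsState β (heisWeightedHamiltonian L n w)
        (productOp fun y => neelDiagonal L hL (fun k => (dd (σ x) k : ℂ)) y)).re := by
  obtain ⟨R, hRR, hRR', hRz, hconj⟩ := exists_productOp_conj_heisWeightedFieldHamiltonian L hL hL3 n
  set u : TorusSite d L → Matrix (Fin (n + 1)) (Fin (n + 1)) ℂ :=
    fun z => if torusSiteParity L hL z = 0 then 1 else R with hu
  have hua : ∀ z, u z * (u z)ᴴ = 1 := by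
    intro z; simp only [hu]; split_ifs
    · rw [conjTranspose_one, Matrix.mul_one]
    · exact hRR
  have hub : ∀ z, (u z)ᴴ * u z = 1 := by
    intro z; simp only [hu]; split_ifs
    · rw [conjTranspose_one, Matrix.mul_one]
    · exact hRR'
  set W := productOp u with hW
  have hWW : Wᴴ * W = 1 := by rw [hW]; exact productOp_conjTranspose_mul hub
  have hWW' : W * Wᴴ = 1 := by rw [hW]; exact productOp_mul_conjTranspose hua
  -- the physical Hamiltonian is `Wᴴ H♭ W`
  have hH : heisWeightedHamiltonian L n w = Wᴴ * heisWeightedRealFieldHamiltonian L n w 0 * W := by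
    rw [← hconj w 0]
    simp only [← Matrix.mul_assoc, hWW, Matrix.one_mul]
    rw [Matrix.mul_assoc, hWW, Matrix.mul_one]
    exact (heisWeightedFieldHamiltonian_zero L n w).symm
  have key : ∀ B, Matrix.gibbsState β (heisWeightedHamiltonian L n w) (Wᴴ * B * W) =
      Matrix.gibbsState β (heisWeightedRealFieldHamiltonian L n w 0) B := by
    intro B
    rw [hH]
    exact neelAux_gibbsState_unitary_conj β hWW hWW' _ B
  -- the rotated diagonal observables, site by site: `u_yᴴ diag(d) u_y = N_y(d)`
  have hsite : ∀ (b : ι) (y : TorusSite d L),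
      (u y)ᴴ * diagonal (fun k => (dd b k : ℂ)) * u y =
        neelDiagonal L hL (fun k => (dd b k : ℂ)) y := by
    intro b y
    simp only [hu, neelDiagonal]
    split_ifs
    · rw [conjTranspose_one, Matrix.one_mul, Matrix.mul_one]
    · exact conjTranspose_conj_diagonal_of_conj_spinZ_eq_neg hRR hRR' hRz _
  have hobs : ∀ b : ι,
      Wᴴ * (productOp fun _ : TorusSite d L => diagonal fun k => (dd b k : ℂ)) * W =
        productOp fun y => neelDiagonal L hL (fun k => (dd b k : ℂ)) y := by
    intro b
    rw [hW, productOp_conjTranspose, productOp_mul, productOp_mul]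
    exact congrArg productOp (funext fun y => hsite b y)
  have hobsσ :
      Wᴴ * (productOp fun x : TorusSite d L => diagonal fun k => (dd (σ x) k : ℂ)) * W =
        productOp fun x => neelDiagonal L hL (fun k => (dd (σ x) k : ℂ)) x := by
    rw [hW, productOp_conjTranspose, productOp_mul, productOp_mul]
    exact congrArg productOp (funext fun y => hsite (σ y) y)
  -- real diagonal observables are real matrices
  have hreal : ∀ b : ι, (diagonal fun k => (dd b k : ℂ)).map (starRingEnd ℂ) =
      diagonal fun k => (dd b k : ℂ) := by
    intro b
    ext i j
    rw [map_apply, diagonal_apply]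
    split_ifs
    · exact Complex.conj_ofReal _
    · exact map_zero _
  -- the rotated-frame estimate, carried over
  have h := chessboard_estimate_gibbs_real L hd hL
    (heisWeightedRealFieldHamiltonian_isHermitian L n w 0)
    (heisWeightedReal_isRPExponent L n hL hw0 hwθ hβ) (fun b => diagonal fun k => (dd b k : ℂ))
    hreal σ
  rw [← hobsσ, key]
  have hfac : ∀ x, (Matrix.gibbsState β (heisWeightedHamiltonian L n w)
      (productOp fun y => neelDiagonal L hL (fun k => (dd (σ x) k : ℂ)) y)).re =
      (Matrix.gibbsState β (heisWeightedRealFieldHamiltonian L n w 0)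
        (productOp fun _ : TorusSite d L => diagonal fun k => (dd (σ x) k : ℂ))).re := by
    intro x
    rw [← hobs (σ x), key]
  simp only [hfac]
  exact h

/-- **The chessboard estimate for the antiferromagnet with direction-dependent couplings**
`H = Σ_x Σ_i K_i 𝐒_x·𝐒_{x+e_i}`, `K ≥ 0` (tree `heisAnisoTorus L n K`, Kennedy–Lieb–Shastry
eq. (5)) in the physical frame, Néel-staggered diagonal observables: the special case
`w = dirCoupling L K` of `heisWeighted_chessboard_estimate_neel`.
[cite: FrohlichLieb1978, Thm. 2.2, §I.A (3)] [cite: KLS1988JSP, eq. (5)] -/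
theorem heisAniso_chessboard_estimate_neel (hd : 0 < d) (hL : Even L) (hL3 : 3 ≤ L) (n : ℕ)
    {K : Fin d → ℝ} (hK : ∀ i, 0 ≤ K i) {β : ℝ} (hβ : 0 ≤ β) {ι : Type*}
    (dd : ι → Fin (n + 1) → ℝ) (σ : TorusSite d L → ι) :
    |(Matrix.gibbsState β (heisAnisoTorus L n K)
        (productOp fun x => neelDiagonal L hL (fun k => (dd (σ x) k : ℂ)) x)).re| ^ (L ^ d) ≤
      ∏ x, (Matrix.gibbsState β (heisAnisoTorus L n K)
        (productOp fun y => neelDiagonal L hL (fun k => (dd (σ x) k : ℂ)) y)).re :=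
  heisWeighted_chessboard_estimate_neel L hd hL hL3 n (dirCoupling_nonneg L hK)
    (fun j a e => dirCoupling_map_reflectBetweenSites L j a K e) hβ dd σ

end Physical

end Literature.MathematicalPhysics.QuantumLattice

end
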